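import Literature.Computability.Cryptography.ChenQuantumLWEJointDatumPrivacy
import Literature.Computability.Cryptography.ChenQuantumLWEDatumOptimum

/-!
# The exact optimum of the JOINT multi-run datum read-out of Chen's Step-9 registers, every `Q` (T14)

REPRODUCTION / ANALYSIS OF A CLAIMED RESULT UNDER ADJUDICATION (withdrawn): Yilei Chen, *Quantum
Algorithms for Lattice Problems*, IACR ePrint 2024/555, version of 2024-04-18 [ChenQuantumLattice2024]
(the version carrying the author's note that Step 9 contains a bug), Step 9 (§3.5.9, pp. 34–38) acting
on `|φ8.b⟩ = Σ_{j ∈ ℤ_P} e(-j²/P) |2D²j·b + v′ mod N⟩` (p. 35), `P = p₁Q`, `N = D²P`, and the repetition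
of the whole procedure over several runs (§3.6, p. 38).  Bundle `papers/QuantumAdvantage/lwe-quantum-autopsy/`,
Part 2 (`REPAIR-CENSUS.md` §1 theorem **T14** and §21), on top of `ChenQuantumLWEJointDatumPrivacy.lean`
(T11: the joint class model `jointDatumKet` of run `0` and its sibling runs and the factorisation
`ketGram_jointDatumKet`) and `ChenQuantumLWEDatumOptimum.lean` (T13: the keyed-block lemma
`POVM.sum_weight_le_of_keyed`, the value `datumValue`, the general datum read-out `datumReadoutGen`).
HONEST FRAMING: kernel-checked THEOREMS about a state occurring in a WITHDRAWN algorithm — here the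
EXACT VALUE, for EVERY modulus `Q` and EVERY number of jointly measured runs, of an information quantity
(how well ANY joint measurement of all the Step-9 registers can read the datum one run consumes), i.e. a
decidable verdict completing a precise NEGATIVE result; NOT summit progress, no cryptanalytic claim in
either direction, no new algorithm for any lattice problem; quantum lower bounds are out of scope.

## The question

T13 (`datum_success_prob_isGreatest`) determines, for every `Q`, the best probability with which a
measurement of ONE Step-9 register guesses that run's datum `a ∈ ℤ_Q` in the class model:
`V(Q, m) = Q^{-m}·Σ_{β ∈ ℤ_Q^U} 1/#span(β)`, `m = #U`.  For SEVERAL runs measured JOINTLY (run `0` with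
datum `a`, sibling runs `k ∈ κ` sharing the secret but carrying fresh data), T11
(`joint_datum_success_prob_le`) only gives the coarse bound `1/Q + (1 − 1/Q)·π_B`, which coincides with
`V(Q, m)` for prime `Q` but not for the composite `Q = (c+1)‖b‖²/p₁` of Chen's parameters (e.g.
`Q = 15`, `m = 1`: `V = 0.200` against `0.502`; `Q = 105`, `m = 1`: `0.0531` against `0.547`).  Can a
joint measurement of all the registers beat the single-register optimum `V(Q, m)`?  No:

## What is proved (every `Q`, every finite `κ`; `P` odd, Cond. C.3)

* **Upper bound** (`joint_datum_success_prob_le_value`): for EVERY POVM on the JOINT registers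
  `ℤ_N^{n+1} × (κ → ℤ_N^{n+1})` with outcomes in `ℤ_Q`, the joint-class success probability for run `0`'s
  datum is `≤ V(Q, m)`.  Mechanism: T13's keyed-block lemma `POVM.sum_weight_le_of_keyed` on the joint
  space, keyed by run `0`'s residue pattern `ū` ALONE — by T11's factorisation
  `ρ^{joint}_a = ρ_a ⊗ (⊗_k ρ̄_k)` the joint state is block diagonal in `ū` (T10) and, on the block
  `ū = β`, depends on `a` only through the class `a + span(β)` (T13's `datumGram_eq_of_sub_mem_span`);
  the siblings contribute a datum-free factor.
* **Attainment** (`POVM.prodFst`, `jointReadout_weight`): T13's general datum read-out on run `0`'s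
  register tensored with the identity on the siblings (`E_a ⊗ 1`, built from PUBLIC data `(U, bk, v′)`)
  gives EVERY member of the joint class the Born weight of a correct guess EXACTLY
  `V(Q, m)·(P·N^{n+1})^{#κ+1}` (the member's squared norm is `(P·N^{n+1})^{#κ+1}`).
* Hence (`joint_datum_success_prob_eq_value`, `joint_datum_success_prob_isGreatest`,
  `joint_datum_minimax`): `V(Q, m)` is the EXACT optimum over ALL joint POVMs, Bayes and minimax, for
  every `Q` and every `κ` — the siblings are worthless for reading run `0`'s datum, exactly, not just up
  to T11's coarse bound; `Shape.joint_datum_privacy_optimum` renders it for every admissible shape, and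
  `datumValue_le_coarse` records `V(Q, m) ≤ 1/Q + (1 − 1/Q)·π_B` (T11's bound is never sharper).

Reading (census T14 / rows G1, G2, §6 item (4)): the several-runs threshold of §6 item (4) is now the
single-run value `V(C, m)` EXACTLY for every modulus, closing the last quantitative gap of the datum
census (factor ≈ 10 at `C = 105`, `m = 1`).  Nothing here rescues Step 9 (T5: a wrong datum yields a
uniformly shifted, useless relation).

## What is NOT here

Adaptive choices of LATER runs' public offsets as functions of earlier outcomes beyond the class model
(T11's scope remark applies verbatim: the offsets `w k` are arbitrary but fixed); the identification of
the class shifts with all secret-ignorant side information (census §0, by hand); any algorithm.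

References: [ChenQuantumLattice2024] as above; [NielsenChuang2010] §2.2.6 (POVMs), §2.4.1 (reduced
states of product states), Box 2.3 / §9.2 (state discrimination).
-/

namespace Literature.Computability.Cryptography.Chen2024

open scoped BigOperators ComplexOrder Kronecker
open Matrix

/-! ### 1. An abstract lemma: a POVM on the first tensor factor -/

section ProdFst

variable {X A : Type*} [Fintype X] [DecidableEq X] [Fintype A]
  {Y : Type*} [Fintype Y] [DecidableEq Y]

variable (Y) in
/-- **A POVM on the first register, acting trivially on the second**: `E_a ⊗ 1`.
[cite: NielsenChuang2010, §2.2.6 p. 90, §2.4.1 p. 99] -/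
noncomputable def POVM.prodFst (E : POVM X A) : POVM (X × Y) A where
  effect a := E.effect a ⊗ₖ (1 : Matrix Y Y ℂ)
  posSemidef a := (E.posSemidef a).kronecker Matrix.PosSemidef.one
  sum_eq_one := by
    have h : ∑ a, E.effect a ⊗ₖ (1 : Matrix Y Y ℂ) = (∑ a, E.effect a) ⊗ₖ (1 : Matrix Y Y ℂ) := by
      ext ⟨x, y⟩ ⟨x', y'⟩
      simp only [Matrix.sum_apply, kroneckerMap_apply, Finset.sum_mul]
    rw [h, E.sum_eq_one, one_kronecker_one]

omit [DecidableEq X] in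
/-- `(M ⊗ 1)(φ ⊗ χ) = (Mφ) ⊗ χ`, entrywise. [folklore] -/
theorem kronecker_one_mulVec_tmul (M : Matrix X X ℂ) (φ : X → ℂ) (χ : Y → ℂ) (x : X) (y : Y) :
    ((M ⊗ₖ (1 : Matrix Y Y ℂ)) *ᵥ fun xy : X × Y => φ xy.1 * χ xy.2) (x, y) = (M *ᵥ φ) x * χ y := by
  simp only [mulVec, dotProduct, Fintype.sum_prod_type, kroneckerMap_apply, Matrix.one_apply, mul_ite,
    mul_one, mul_zero, ite_mul, zero_mul, Finset.sum_ite_eq, Finset.mem_univ, if_true]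
  rw [Finset.sum_mul]
  refine Finset.sum_congr rfl fun x' _ => ?_
  ring

/-- **Weights of `E ⊗ 1` on product kets**: `⟨φ ⊗ χ|(E_a ⊗ 1)|φ ⊗ χ⟩ = ⟨φ|E_a|φ⟩·⟨χ|χ⟩`.
[cite: NielsenChuang2010, §2.4.1 p. 99] -/
theorem POVM.prodFst_weight_tmul (E : POVM X A) (φ : X → ℂ) (χ : Y → ℂ) (a : A) :
    (E.prodFst Y).weight (fun xy : X × Y => φ xy.1 * χ xy.2) a = E.weight φ a * (star χ ⬝ᵥ χ) := by
  unfold POVM.weight dotProduct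
  rw [Fintype.sum_prod_type, Finset.sum_mul_sum]
  refine Finset.sum_congr rfl fun x _ => Finset.sum_congr rfl fun y _ => ?_
  rw [show (E.prodFst Y).effect a = E.effect a ⊗ₖ (1 : Matrix Y Y ℂ) from rfl,
    kronecker_one_mulVec_tmul (E.effect a) φ χ x y]
  simp only [Pi.star_apply, star_mul']
  ring

end ProdFst

/-! ### 2. T14, upper bound: no joint measurement beats `V(Q, m)` -/

section Joint

variable (n : ℕ) (D p₁ Q : ℕ+) {κ : Type*} [Fintype κ] [DecidableEq κ]

/-- **T14, upper bound (weight form, every `Q`).**  For EVERY POVM on the JOINT Step-9 registers of run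
`0` and of the sibling runs `κ`, outcomes in `ℤ_Q` read as a guess of run `0`'s datum, and odd `P`:
`Σ_a Σ_{(s,c,e)} ⟨member|E_a|member⟩ ≤ Σ_β (1/#span β)·Q·(#{ū = β}·N^{(n+1)#κ})·C`,
`C = Q^{n+1}Q^{n+1}P·(Q^{n+2}P)^{#κ}` — the keyed-block lemma keyed by run `0`'s residue pattern alone.
[cite: ChenQuantumLattice2024, §3.5.9 pp. 35–38, §3.6 p. 38; NielsenChuang2010, §2.2.6 p. 90, Box 2.3 p. 87] -/
theorem joint_datum_weight_le_span (hP : Odd ((p₁ * Q : ℕ+) : ℕ)) (U : Finset (Fin (n + 1)))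
    (bk b v' : Fin (n + 1) → ℤ) (hbk : ∀ i, i ∉ U → bk i = b i) (w : κ → Fin (n + 1) → ℤ)
    (E : POVM ((Fin (n + 1) → ZN D p₁ Q) × (κ → (Fin (n + 1) → ZN D p₁ Q))) (ZQ Q)) :
    ∑ a, ∑ i, E.weight (jointDatumKet n D p₁ Q U bk b v' w a i) a
      ≤ ∑ β : U → ZQ Q, (((Nat.card (span Q β) : ℝ)⁻¹ : ℝ) : ℂ)
          * ((((Q : ℕ+) : ℕ) : ℂ)
            * ((Nat.card {u : Fin (n + 1) → ZN D p₁ Q // resid n D p₁ Q U u = β} : ℂ)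
              * (((((D * D * (p₁ * Q) : ℕ+) : ℕ) : ℂ)) ^ (n + 1)) ^ Fintype.card κ)
            * (((((Q : ℕ+) : ℕ) : ℂ)) ^ (n + 1) * ((((Q : ℕ+) : ℕ) : ℂ)) ^ (n + 1)
                * ((((p₁ * Q : ℕ+) : ℕ) : ℂ))
              * (((((Q : ℕ+) : ℕ) : ℂ)) ^ (n + 2) * ((((p₁ * Q : ℕ+) : ℕ) : ℂ))) ^ Fintype.card κ)) := by
  classical
  have h := E.sum_weight_le_of_keyed (jointDatumKet n D p₁ Q U bk b v' w)
    (fun x => resid n D p₁ Q U x.1)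
    (fun β a a' => a' - a ∈ span Q β) (fun β => Nat.card (span Q β)) (fun β => card_span_pos Q β)
    (fun β a => card_class_eq Q β a)
    (fun β a a' x x' hrel hx hx' => by
      rw [ketGram_jointDatumKet n D p₁ Q U bk b v' hbk, ketGram_jointDatumKet n D p₁ Q U bk b v' hbk,
        datumGram_eq_of_sub_mem_span n D p₁ Q U bk b v' hbk (isUnit_four_of_odd p₁ Q hP)
          (hx.trans hx'.symm) (by rw [hx]; exact hrel)])
    (fun a x x' hx => by
      rw [ketGram_jointDatumKet n D p₁ Q U bk b v' hbk]
      obtain ⟨i, -, hi⟩ := exists_classFreq_ne_of_resid_ne n D p₁ Q U hx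
      rw [datumGram_eq_zero_of_classFreq_ne n D p₁ Q U bk b v' a x.1 x'.1 hi, zero_mul])
  refine h.trans (le_of_eq (Finset.sum_congr rfl fun β _ => ?_))
  congr 1
  simp only [ketGram_jointDatumKet_self n D p₁ Q hP U bk b v' hbk, Finset.sum_const, Finset.card_univ,
    ZMod.card, nsmul_eq_mul, Nat.card_eq_fintype_card, Fintype.card_subtype]
  rw [card_filter_fst n D p₁ Q (fun u => resid n D p₁ Q U u = β)]
  push_cast
  ring

/-- **T14, upper bound (probability form, every `Q`).**  Normalising by the total weight of the joint
class (`joint_datum_totalWeight`): with run `0`'s datum `a`, the common secret shift `s`, run `0`'s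
offset shift `c` and every sibling's data uniform, EVERY joint measurement of all the Step-9 registers
guesses `a` correctly with probability at most `V(Q, m) = Q^{-m}Σ_β 1/#span(β)`, `m = #U` — the
single-register optimum of T13, for prime AND composite `Q` (`P` odd, Cond. C.3).
[cite: ChenQuantumLattice2024, §3.5.9 pp. 35–38, §3.6 p. 38; NielsenChuang2010, Box 2.3 p. 87] -/
theorem joint_datum_success_prob_le_value (hP : Odd ((p₁ * Q : ℕ+) : ℕ)) (U : Finset (Fin (n + 1)))
    (bk b v' : Fin (n + 1) → ℤ) (hbk : ∀ i, i ∉ U → bk i = b i) (w : κ → Fin (n + 1) → ℤ)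
    (E : POVM ((Fin (n + 1) → ZN D p₁ Q) × (κ → (Fin (n + 1) → ZN D p₁ Q))) (ZQ Q)) :
    (∑ a, ∑ i, E.weight (jointDatumKet n D p₁ Q U bk b v' w a i) a).re
        / (∑ a : ZQ Q, ∑ i,
            star (jointDatumKet n D p₁ Q U bk b v' w a i) ⬝ᵥ jointDatumKet n D p₁ Q U bk b v' w a i).re
      ≤ datumValue Q U := by
  classical
  have hQ : (0 : ℝ) < ((Q : ℕ+) : ℕ) := by exact_mod_cast PNat.pos Q
  have hP' : (0 : ℝ) < ((p₁ * Q : ℕ+) : ℕ) := by exact_mod_cast PNat.pos _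
  have hN : (0 : ℝ) < ((D * D * (p₁ * Q) : ℕ+) : ℕ) := by exact_mod_cast PNat.pos _
  -- the common diagonal factor `C = Q^{n+1}Q^{n+1}P·(Q^{n+2}P)^{#κ}` and the sibling volume `N^{(n+1)#κ}`
  set C : ℝ := ((((Q : ℕ+) : ℕ) : ℝ)) ^ (n + 1) * ((((Q : ℕ+) : ℕ) : ℝ)) ^ (n + 1)
      * ((((p₁ * Q : ℕ+) : ℕ) : ℝ))
    * (((((Q : ℕ+) : ℕ) : ℝ)) ^ (n + 2) * ((((p₁ * Q : ℕ+) : ℕ) : ℝ))) ^ Fintype.card κ with hC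
  set W : ℝ := (((((D * D * (p₁ * Q) : ℕ+) : ℕ) : ℝ)) ^ (n + 1)) ^ Fintype.card κ with hW
  have hCpos : 0 < C := by positivity
  have hWpos : 0 < W := by positivity
  have hB : ∀ β : U → ZQ Q,
      (Nat.card {u : Fin (n + 1) → ZN D p₁ Q // resid n D p₁ Q U u = β} : ℝ) * (((Q : ℕ+) : ℕ) : ℝ) ^ U.card
        = (((D * D * (p₁ * Q) : ℕ+) : ℕ) : ℝ) ^ (n + 1) :=
    fun β => by exact_mod_cast card_resid_mul n D p₁ Q U β
  have hden : (∑ a : ZQ Q, ∑ i, star (jointDatumKet n D p₁ Q U bk b v' w a i)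
      ⬝ᵥ jointDatumKet n D p₁ Q U bk b v' w a i).re
        = (((Q : ℕ+) : ℕ) : ℝ) * (C * W) * (((D * D * (p₁ * Q) : ℕ+) : ℕ) : ℝ) ^ (n + 1) := by
    rw [joint_datum_totalWeight n D p₁ Q hP, Complex.natCast_re, hC, hW]
    push_cast
    ring
  have hnum : (∑ a, ∑ i, E.weight (jointDatumKet n D p₁ Q U bk b v' w a i) a).re
      ≤ ∑ β : U → ZQ Q, ((Nat.card (span Q β) : ℝ))⁻¹
          * ((((Q : ℕ+) : ℕ) : ℝ)
            * ((Nat.card {u : Fin (n + 1) → ZN D p₁ Q // resid n D p₁ Q U u = β} : ℝ) * W) * C) := by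
    have h := (Complex.le_def.1 (joint_datum_weight_le_span n D p₁ Q hP U bk b v' hbk w E)).1
    refine h.trans (le_of_eq ?_)
    rw [Complex.re_sum, hC, hW]
    refine Finset.sum_congr rfl fun β _ => ?_
    simp only [← Complex.ofReal_natCast, ← Complex.ofReal_mul, ← Complex.ofReal_pow, Complex.ofReal_re]
  rw [hden, div_le_iff₀ (by positivity)]
  refine hnum.trans (le_of_eq ?_)
  unfold datumValue
  rw [Fintype.card_coe, div_mul_eq_mul_div, eq_div_iff (pow_ne_zero _ hQ.ne'), Finset.sum_mul,
    Finset.sum_mul]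
  refine Finset.sum_congr rfl fun β _ => ?_
  linear_combination (((Nat.card (span Q β) : ℝ))⁻¹ * (((Q : ℕ+) : ℕ) : ℝ) * W * C) * hB β

/-! ### 3. T14, attainment: the general datum read-out on run `0`, identity on the siblings -/

/-- The siblings' factor of a joint member has squared norm `(P·N^{n+1})^{#κ}` (flat spectrum `P`, T3).
[cite: ChenQuantumLattice2024, §3.5.9 p. 35] -/
theorem siblings_normSq (hP : Odd ((p₁ * Q : ℕ+) : ℕ)) (U : Finset (Fin (n + 1)))
    (bk b : Fin (n + 1) → ℤ) (w : κ → Fin (n + 1) → ℤ) (s : Fin (n + 1) → ZQ Q)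
    (e : κ → ZQ Q × (Fin (n + 1) → ZQ Q)) :
    star (fun z : κ → (Fin (n + 1) → ZN D p₁ Q) => ∏ k, siblingKet n D p₁ Q U bk b (w k) s (e k) (z k))
        ⬝ᵥ (fun z : κ → (Fin (n + 1) → ZN D p₁ Q) => ∏ k, siblingKet n D p₁ Q U bk b (w k) s (e k) (z k))
      = ((((((p₁ * Q : ℕ+) : ℕ)) * ((D * D * (p₁ * Q) : ℕ+) : ℕ) ^ (n + 1)) ^ Fintype.card κ : ℕ) : ℂ) := by
  have hk : ∀ k (y : Fin (n + 1) → ZN D p₁ Q),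
      (starRingEnd ℂ) (siblingKet n D p₁ Q U bk b (w k) s (e k) y) * siblingKet n D p₁ Q U bk b (w k) s (e k) y
        = ((((p₁ * Q : ℕ+) : ℕ) : ℂ)) := fun k y => by
    rw [mul_comm]
    exact fourierGram_self n D p₁ Q hP _ _ y
  simp only [dotProduct, Pi.star_apply, Complex.star_def, map_prod]
  simp_rw [← Finset.prod_mul_distrib, hk]
  rw [Finset.prod_const, Finset.card_univ, Finset.sum_const, Finset.card_univ, nsmul_eq_mul]
  simp only [Fintype.card_fun, ZMod.card, Fintype.card_fin]
  push_cast
  ring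

/-- **The joint datum read-out** (T14): T13's general datum read-out on run `0`'s register, the identity
on the siblings' registers — `E_a ⊗ 1`, built from PUBLIC data `(U, bk, v′)` only.
[cite: ChenQuantumLattice2024, §3.5.9 pp. 35–37; NielsenChuang2010, Box 2.3 p. 87, §2.4.1 p. 99] -/
noncomputable def jointReadout (hP : Odd ((p₁ * Q : ℕ+) : ℕ)) (U : Finset (Fin (n + 1)))
    (bk v' : Fin (n + 1) → ℤ) (hunit : ∃ i₀, i₀ ∉ U ∧ IsUnit ((bk i₀ : ℤ) : ZQ Q)) :
    POVM ((Fin (n + 1) → ZN D p₁ Q) × (κ → (Fin (n + 1) → ZN D p₁ Q))) (ZQ Q) :=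
  (datumReadoutGen n D p₁ Q hP U bk v' hunit).prodFst (κ → (Fin (n + 1) → ZN D p₁ Q))

/-- **T14 (the joint datum read-out attains the value on EVERY joint member).**  For odd `P`, `b ≡ bk`
off `U`, `b ≡ bk ≡ 0 (mod p₁)` on `U`, a unit coordinate `bk_{i₀}`, `i₀ ∉ U`: for EVERY datum `a`,
secret shift `s`, offset shift `c` and siblings' data `e`, the joint datum read-out outputs `a` on the
member `(a, ((s, c), e))` with Born weight EXACTLY `V(Q, m)·(P·N^{n+1})^{#κ+1}`.
[cite: ChenQuantumLattice2024, §3.5.9 pp. 35–38, §3.6 p. 38, eq. (12) p. 17; NielsenChuang2010, Box 2.3 p. 87] -/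
theorem jointReadout_weight (hP : Odd ((p₁ * Q : ℕ+) : ℕ)) (U : Finset (Fin (n + 1)))
    (bk b v' : Fin (n + 1) → ℤ)
    (hb : ∀ i ∈ U, ((p₁ : ℕ) : ℤ) ∣ b i) (hbkU : ∀ i ∈ U, ((p₁ : ℕ) : ℤ) ∣ bk i)
    (hbk : ∀ i, i ∉ U → bk i = b i) (hunit : ∃ i₀, i₀ ∉ U ∧ IsUnit ((bk i₀ : ℤ) : ZQ Q))
    (w : κ → Fin (n + 1) → ℤ) (a : ZQ Q)
    (i : ((Fin (n + 1) → ZQ Q) × (Fin (n + 1) → ZQ Q)) × (κ → ZQ Q × (Fin (n + 1) → ZQ Q))) :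
    (jointReadout n D p₁ Q hP U bk v' hunit).weight (jointDatumKet n D p₁ Q U bk b v' w a i) a
      = (((datumValue Q U)
          * (((((p₁ * Q : ℕ+) : ℕ) : ℝ) * (((D * D * (p₁ * Q) : ℕ+) : ℕ) : ℝ) ^ (n + 1))
              ^ (Fintype.card κ + 1)) : ℝ) : ℂ) := by
  have h1 := POVM.prodFst_weight_tmul (Y := κ → (Fin (n + 1) → ZN D p₁ Q))
    (datumReadoutGen n D p₁ Q hP U bk v' hunit) (datumKet n D p₁ Q U bk b v' a i.1)
    (fun z : κ → (Fin (n + 1) → ZN D p₁ Q) => ∏ k, siblingKet n D p₁ Q U bk b (w k) i.1.1 (i.2 k) (z k)) a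
  rw [datumReadoutGen_weight n D p₁ Q hP U bk b v' hb hbkU hbk hunit,
    siblings_normSq n D p₁ Q hP U bk b w i.1.1 i.2] at h1
  refine h1.trans ?_
  push_cast
  ring

/-! ### 4. Probability form; the exact joint optimum for every `Q` and every `κ` -/

/-- **T14 (probability form).**  With run `0`'s datum, the common secret shift, run `0`'s offset shift and
the siblings' data uniform, the joint datum read-out guesses run `0`'s datum correctly with probability
EXACTLY `V(Q, m)`. [cite: ChenQuantumLattice2024, §3.5.9 pp. 35–38, §3.6 p. 38] -/
theorem joint_datum_success_prob_eq_value (hP : Odd ((p₁ * Q : ℕ+) : ℕ)) (U : Finset (Fin (n + 1)))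
    (bk b v' : Fin (n + 1) → ℤ)
    (hb : ∀ i ∈ U, ((p₁ : ℕ) : ℤ) ∣ b i) (hbkU : ∀ i ∈ U, ((p₁ : ℕ) : ℤ) ∣ bk i)
    (hbk : ∀ i, i ∉ U → bk i = b i) (hunit : ∃ i₀, i₀ ∉ U ∧ IsUnit ((bk i₀ : ℤ) : ZQ Q))
    (w : κ → Fin (n + 1) → ℤ) :
    (∑ a, ∑ i, (jointReadout n D p₁ Q hP U bk v' hunit).weight (jointDatumKet n D p₁ Q U bk b v' w a i) a).re
        / (∑ a : ZQ Q, ∑ i,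
            star (jointDatumKet n D p₁ Q U bk b v' w a i) ⬝ᵥ jointDatumKet n D p₁ Q U bk b v' w a i).re
      = datumValue Q U := by
  simp only [jointReadout_weight n D p₁ Q hP U bk b v' hb hbkU hbk hunit w, jointDatumKet_normSq n D p₁ Q hP]
  rw [Finset.sum_const, Finset.card_univ, Finset.sum_const, Finset.card_univ, smul_smul, nsmul_eq_mul,
    ← Complex.ofReal_natCast, ← Complex.ofReal_mul, Complex.ofReal_re,
    Finset.sum_const, Finset.card_univ, Finset.sum_const, Finset.card_univ, smul_smul, nsmul_eq_mul,
    ← Nat.cast_mul, Complex.natCast_re]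
  have hQ : (0 : ℝ) < ((Q : ℕ+) : ℕ) := by exact_mod_cast PNat.pos Q
  have hP' : (0 : ℝ) < ((p₁ * Q : ℕ+) : ℕ) := by exact_mod_cast PNat.pos _
  have hN : (0 : ℝ) < ((D * D * (p₁ * Q) : ℕ+) : ℕ) := by exact_mod_cast PNat.pos _
  have hI : (0 : ℝ) < (Fintype.card (ZQ Q)
      * Fintype.card (((Fin (n + 1) → ZQ Q) × (Fin (n + 1) → ZQ Q))
          × (κ → ZQ Q × (Fin (n + 1) → ZQ Q))) : ℕ) := by
    exact_mod_cast Nat.mul_pos Fintype.card_pos Fintype.card_pos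
  rw [div_eq_iff (by positivity)]
  push_cast
  ring

/-- **T14: the exact joint optimum, every `Q`, every `κ`.**  `V(Q, m) = Q^{-m}·Σ_{β ∈ ℤ_Q^U} 1/#span(β)`
is the GREATEST success probability for run `0`'s datum over ALL POVMs on the JOINT Step-9 registers of
run `0` and its siblings (attained: the joint datum read-out; upper bound:
`joint_datum_success_prob_le_value`) — the single-register value of T13: jointly measuring the sibling
runs does not help, for prime AND composite `Q`.
[cite: ChenQuantumLattice2024, §3.5.9 pp. 35–38, §3.6 p. 38; NielsenChuang2010, Box 2.3 p. 87] -/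
theorem joint_datum_success_prob_isGreatest (hP : Odd ((p₁ * Q : ℕ+) : ℕ)) (U : Finset (Fin (n + 1)))
    (bk b v' : Fin (n + 1) → ℤ)
    (hb : ∀ i ∈ U, ((p₁ : ℕ) : ℤ) ∣ b i) (hbkU : ∀ i ∈ U, ((p₁ : ℕ) : ℤ) ∣ bk i)
    (hbk : ∀ i, i ∉ U → bk i = b i) (hunit : ∃ i₀, i₀ ∉ U ∧ IsUnit ((bk i₀ : ℤ) : ZQ Q))
    (w : κ → Fin (n + 1) → ℤ) :
    IsGreatest (Set.range fun E : POVM ((Fin (n + 1) → ZN D p₁ Q) × (κ → (Fin (n + 1) → ZN D p₁ Q))) (ZQ Q) =>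
        (∑ a, ∑ i, E.weight (jointDatumKet n D p₁ Q U bk b v' w a i) a).re
          / (∑ a : ZQ Q, ∑ i, star (jointDatumKet n D p₁ Q U bk b v' w a i)
              ⬝ᵥ jointDatumKet n D p₁ Q U bk b v' w a i).re)
      (datumValue Q U) := by
  refine ⟨⟨jointReadout n D p₁ Q hP U bk v' hunit,
    joint_datum_success_prob_eq_value n D p₁ Q hP U bk b v' hb hbkU hbk hunit w⟩, ?_⟩
  rintro _ ⟨E, rfl⟩
  exact joint_datum_success_prob_le_value n D p₁ Q hP U bk b v' hbk w E

/-- **T14, minimax (worst case over the joint class).**  No joint measurement outputs run `0`'s datum with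
Born weight above `V·(P·N^{n+1})^{#κ+1}` on EVERY member of the joint class (some member is at most the
average), and the joint datum read-out achieves exactly `V·(P·N^{n+1})^{#κ+1}` on every member: the
worst-case value over all joint POVMs is `V(Q, m)` too.
[cite: ChenQuantumLattice2024, §3.5.9 pp. 35–38, §3.6 p. 38] -/
theorem joint_datum_minimax (hP : Odd ((p₁ * Q : ℕ+) : ℕ)) (U : Finset (Fin (n + 1)))
    (bk b v' : Fin (n + 1) → ℤ)
    (hb : ∀ i ∈ U, ((p₁ : ℕ) : ℤ) ∣ b i) (hbkU : ∀ i ∈ U, ((p₁ : ℕ) : ℤ) ∣ bk i)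
    (hbk : ∀ i, i ∉ U → bk i = b i) (hunit : ∃ i₀, i₀ ∉ U ∧ IsUnit ((bk i₀ : ℤ) : ZQ Q))
    (w : κ → Fin (n + 1) → ℤ) :
    (∀ E : POVM ((Fin (n + 1) → ZN D p₁ Q) × (κ → (Fin (n + 1) → ZN D p₁ Q))) (ZQ Q), ∃ a : ZQ Q,
        ∃ i : ((Fin (n + 1) → ZQ Q) × (Fin (n + 1) → ZQ Q)) × (κ → ZQ Q × (Fin (n + 1) → ZQ Q)),
          (E.weight (jointDatumKet n D p₁ Q U bk b v' w a i) a).re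
            ≤ datumValue Q U
              * (((((p₁ * Q : ℕ+) : ℕ) : ℝ) * (((D * D * (p₁ * Q) : ℕ+) : ℕ) : ℝ) ^ (n + 1))
                  ^ (Fintype.card κ + 1)))
    ∧ (∀ a : ZQ Q,
        ∀ i : ((Fin (n + 1) → ZQ Q) × (Fin (n + 1) → ZQ Q)) × (κ → ZQ Q × (Fin (n + 1) → ZQ Q)),
          ((jointReadout n D p₁ Q hP U bk v' hunit).weight (jointDatumKet n D p₁ Q U bk b v' w a i) a).re
            = datumValue Q U
              * (((((p₁ * Q : ℕ+) : ℕ) : ℝ) * (((D * D * (p₁ * Q) : ℕ+) : ℕ) : ℝ) ^ (n + 1))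
                  ^ (Fintype.card κ + 1))) := by
  classical
  refine ⟨fun E => ?_, fun a i => ?_⟩
  · have hQ : (0 : ℝ) < ((Q : ℕ+) : ℕ) := by exact_mod_cast PNat.pos Q
    have hP' : (0 : ℝ) < ((p₁ * Q : ℕ+) : ℕ) := by exact_mod_cast PNat.pos _
    have hN : (0 : ℝ) < ((D * D * (p₁ * Q) : ℕ+) : ℕ) := by exact_mod_cast PNat.pos _
    have hle := joint_datum_success_prob_le_value n D p₁ Q hP U bk b v' hbk w E
    have hden : (∑ a : ZQ Q, ∑ i, star (jointDatumKet n D p₁ Q U bk b v' w a i)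
        ⬝ᵥ jointDatumKet n D p₁ Q U bk b v' w a i).re
          = (Fintype.card (ZQ Q) : ℝ)
            * (Fintype.card (((Fin (n + 1) → ZQ Q) × (Fin (n + 1) → ZQ Q))
                × (κ → ZQ Q × (Fin (n + 1) → ZQ Q))) : ℝ)
            * (((((p₁ * Q : ℕ+) : ℕ) : ℝ) * (((D * D * (p₁ * Q) : ℕ+) : ℕ) : ℝ) ^ (n + 1))
                ^ (Fintype.card κ + 1)) := by
      simp only [jointDatumKet_normSq n D p₁ Q hP, Finset.sum_const, Finset.card_univ, nsmul_eq_mul,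
        ← Nat.cast_mul, Complex.natCast_re]
      push_cast
      ring
    have hI : (0 : ℝ) < (Fintype.card (ZQ Q) : ℝ)
        * (Fintype.card (((Fin (n + 1) → ZQ Q) × (Fin (n + 1) → ZQ Q))
            × (κ → ZQ Q × (Fin (n + 1) → ZQ Q))) : ℝ) := by
      exact_mod_cast Nat.mul_pos Fintype.card_pos Fintype.card_pos
    rw [hden, div_le_iff₀ (by positivity)] at hle
    by_contra hcon
    push Not at hcon
    refine absurd hle (not_le.2 ?_)
    simp only [Complex.re_sum]
    calc datumValue Q U
            * ((Fintype.card (ZQ Q) : ℝ)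
              * (Fintype.card (((Fin (n + 1) → ZQ Q) × (Fin (n + 1) → ZQ Q))
                  × (κ → ZQ Q × (Fin (n + 1) → ZQ Q))) : ℝ)
              * (((((p₁ * Q : ℕ+) : ℕ) : ℝ) * (((D * D * (p₁ * Q) : ℕ+) : ℕ) : ℝ) ^ (n + 1))
                  ^ (Fintype.card κ + 1)))
        = ∑ _a : ZQ Q,
            ∑ _i : ((Fin (n + 1) → ZQ Q) × (Fin (n + 1) → ZQ Q)) × (κ → ZQ Q × (Fin (n + 1) → ZQ Q)),
              datumValue Q U
                * (((((p₁ * Q : ℕ+) : ℕ) : ℝ) * (((D * D * (p₁ * Q) : ℕ+) : ℕ) : ℝ) ^ (n + 1))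
                    ^ (Fintype.card κ + 1)) := by
          rw [Finset.sum_const, Finset.card_univ, Finset.sum_const, Finset.card_univ, smul_smul, nsmul_eq_mul]
          push_cast
          ring
      _ < ∑ a : ZQ Q,
            ∑ i : ((Fin (n + 1) → ZQ Q) × (Fin (n + 1) → ZQ Q)) × (κ → ZQ Q × (Fin (n + 1) → ZQ Q)),
              (E.weight (jointDatumKet n D p₁ Q U bk b v' w a i) a).re :=
          Finset.sum_lt_sum_of_nonempty Finset.univ_nonempty fun a _ =>
            Finset.sum_lt_sum_of_nonempty Finset.univ_nonempty fun i _ => hcon a i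
  · rw [jointReadout_weight n D p₁ Q hP U bk b v' hb hbkU hbk hunit w, Complex.ofReal_re]

/-- **T11's coarse bound is never sharper than the exact value** (every `Q`): `V(Q, m) ≤ 1/Q + (1 − 1/Q)·π_B`,
`π_B = #{non-generic u}/N^{n+1}` — T13's read-out attains `V`, T10 bounds every read-out.
[cite: ChenQuantumLattice2024, §3.5.9 pp. 35–37] -/
theorem datumValue_le_coarse (hP : Odd ((p₁ * Q : ℕ+) : ℕ)) (U : Finset (Fin (n + 1)))
    (bk b v' : Fin (n + 1) → ℤ)
    (hb : ∀ i ∈ U, ((p₁ : ℕ) : ℤ) ∣ b i) (hbkU : ∀ i ∈ U, ((p₁ : ℕ) : ℤ) ∣ bk i)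
    (hbk : ∀ i, i ∉ U → bk i = b i) (hunit : ∃ i₀, i₀ ∉ U ∧ IsUnit ((bk i₀ : ℤ) : ZQ Q)) :
    datumValue Q U
      ≤ 1 / ((Q : ℕ+) : ℕ)
        + (1 - 1 / ((Q : ℕ+) : ℕ))
          * ((Nat.card {u : Fin (n + 1) → ZN D p₁ Q // ¬ IsGeneric n D p₁ Q U u} : ℝ)
              / (((D * D * (p₁ * Q) : ℕ+) : ℕ) : ℝ) ^ (n + 1)) := by
  rw [← datum_success_prob_eq_value n D p₁ Q hP U bk b v' hb hbkU hbk hunit]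
  exact datum_success_prob_le n D p₁ Q hP U bk b v' hbk _

end Joint

end Literature.Computability.Cryptography.Chen2024

/-! ### 5. The `Steps` rendering: T14 for every admissible shape -/

namespace Literature.Computability.Cryptography.Chen2024.Shape

open scoped BigOperators ComplexOrder
open Matrix

variable (S : Shape) {κ : Type*} [Fintype κ] [DecidableEq κ]

/-- **T14 for every admissible shape (attainment).**  Let `U ∌ 0` be the unknown coordinates, `bk` any
PUBLIC vector agreeing with `S.b` off `U` and `≡ 0 (mod p₁)` on `U`, `v′` any representative of run `0`'s
offset class, `w k` the sibling runs' offsets.  The joint datum read-out built from `(U, bk, v′)` outputs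
run `0`'s datum `a` on EVERY member `(a, ((s, c), e))` of the joint class with Born weight exactly
`V(Q, #U)·(P·N^{n+1})^{#κ+1}`.
[cite: ChenQuantumLattice2024, §3.5.9 pp. 35–38, §3.6 p. 38, eq. (12) p. 17, Cond. C.3 p. 18] -/
theorem joint_datum_privacy_optimum_attained (h : S.Admissible) (U : Finset (Fin (S.n + 1)))
    (hU : (0 : Fin (S.n + 1)) ∉ U) (bk : Fin (S.n + 1) → ℤ)
    (hbkU : ∀ i ∈ U, ((S.p₁ : ℕ) : ℤ) ∣ bk i) (hbk : ∀ i, i ∉ U → bk i = S.b i)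
    (v' : Fin (S.n + 1) → ℤ) (w : κ → Fin (S.n + 1) → ℤ) (a : ZQ S.Q)
    (i : ((Fin (S.n + 1) → ZQ S.Q) × (Fin (S.n + 1) → ZQ S.Q)) × (κ → ZQ S.Q × (Fin (S.n + 1) → ZQ S.Q))) :
    (jointReadout S.n S.D S.p₁ S.Q h.odd_P U bk v' (h.exists_unit_coord hU hbk)).weight
        (jointDatumKet S.n S.D S.p₁ S.Q U bk S.b v' w a i) a
      = (((datumValue S.Q U) * ((((S.P : ℕ) : ℝ) * ((S.N : ℕ) : ℝ) ^ (S.n + 1)) ^ (Fintype.card κ + 1)) : ℝ) : ℂ) :=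
  jointReadout_weight S.n S.D S.p₁ S.Q h.odd_P U bk S.b v' (h.p₁_dvd_of_mem hU) hbkU hbk
    (h.exists_unit_coord hU hbk) w a i

/-- **T14 for every admissible shape (the exact joint optimum, every `Q`, every `κ`).**  `V(Q, #U)` is
the greatest success probability for run `0`'s datum over ALL joint measurements of the Step-9 registers
of run `0` and of the sibling runs `κ` (`U ∌ 0`, `bk` public as above) — for the composite
`Q = (c+1)‖b‖²/p₁` of Chen's algorithm as well as for prime `Q`: the several-runs threshold equals the
single-run one.
[cite: ChenQuantumLattice2024, §3.5.9 pp. 35–38, §3.6 p. 38, eq. (12) p. 17, Cond. C.3–C.5 p. 18] -/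
theorem joint_datum_privacy_optimum (h : S.Admissible) (U : Finset (Fin (S.n + 1)))
    (hU : (0 : Fin (S.n + 1)) ∉ U) (bk : Fin (S.n + 1) → ℤ)
    (hbkU : ∀ i ∈ U, ((S.p₁ : ℕ) : ℤ) ∣ bk i) (hbk : ∀ i, i ∉ U → bk i = S.b i)
    (v' : Fin (S.n + 1) → ℤ) (w : κ → Fin (S.n + 1) → ℤ) :
    IsGreatest (Set.range fun E : POVM ((Fin (S.n + 1) → ZN S.D S.p₁ S.Q)
        × (κ → (Fin (S.n + 1) → ZN S.D S.p₁ S.Q))) (ZQ S.Q) =>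
        (∑ a, ∑ i, E.weight (jointDatumKet S.n S.D S.p₁ S.Q U bk S.b v' w a i) a).re
          / (∑ a : ZQ S.Q, ∑ i, star (jointDatumKet S.n S.D S.p₁ S.Q U bk S.b v' w a i)
              ⬝ᵥ jointDatumKet S.n S.D S.p₁ S.Q U bk S.b v' w a i).re)
      (datumValue S.Q U) :=
  joint_datum_success_prob_isGreatest S.n S.D S.p₁ S.Q h.odd_P U bk S.b v' (h.p₁_dvd_of_mem hU) hbkU hbk
    (h.exists_unit_coord hU hbk) w

/-- **The worst-case form for every admissible shape.**  No joint measurement exceeds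
`V(Q,#U)·(P·N^{n+1})^{#κ+1}` on every member of the joint class, and the joint datum read-out achieves it
on every member. [cite: ChenQuantumLattice2024, §3.5.9 pp. 35–38, §3.6 p. 38, Cond. C.3 p. 18] -/
theorem joint_datum_privacy_minimax (h : S.Admissible) (U : Finset (Fin (S.n + 1)))
    (hU : (0 : Fin (S.n + 1)) ∉ U) (bk : Fin (S.n + 1) → ℤ)
    (hbkU : ∀ i ∈ U, ((S.p₁ : ℕ) : ℤ) ∣ bk i) (hbk : ∀ i, i ∉ U → bk i = S.b i)
    (v' : Fin (S.n + 1) → ℤ) (w : κ → Fin (S.n + 1) → ℤ) :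
    (∀ E : POVM ((Fin (S.n + 1) → ZN S.D S.p₁ S.Q) × (κ → (Fin (S.n + 1) → ZN S.D S.p₁ S.Q))) (ZQ S.Q),
        ∃ a : ZQ S.Q,
          ∃ i : ((Fin (S.n + 1) → ZQ S.Q) × (Fin (S.n + 1) → ZQ S.Q))
              × (κ → ZQ S.Q × (Fin (S.n + 1) → ZQ S.Q)),
            (E.weight (jointDatumKet S.n S.D S.p₁ S.Q U bk S.b v' w a i) a).re
              ≤ datumValue S.Q U * ((((S.P : ℕ) : ℝ) * ((S.N : ℕ) : ℝ) ^ (S.n + 1)) ^ (Fintype.card κ + 1)))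
    ∧ (∀ a : ZQ S.Q,
        ∀ i : ((Fin (S.n + 1) → ZQ S.Q) × (Fin (S.n + 1) → ZQ S.Q))
            × (κ → ZQ S.Q × (Fin (S.n + 1) → ZQ S.Q)),
          ((jointReadout S.n S.D S.p₁ S.Q h.odd_P U bk v' (h.exists_unit_coord hU hbk)).weight
              (jointDatumKet S.n S.D S.p₁ S.Q U bk S.b v' w a i) a).re
            = datumValue S.Q U * ((((S.P : ℕ) : ℝ) * ((S.N : ℕ) : ℝ) ^ (S.n + 1)) ^ (Fintype.card κ + 1))) :=
  joint_datum_minimax S.n S.D S.p₁ S.Q h.odd_P U bk S.b v' (h.p₁_dvd_of_mem hU) hbkU hbk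
    (h.exists_unit_coord hU hbk) w

/-- **T11 ≥ T14 for every admissible shape**: the exact several-runs value `V(Q, #U)` never exceeds T11's
coarse bound `1/Q + (1 − 1/Q)·π_B`. [cite: ChenQuantumLattice2024, §3.5.9 pp. 35–38, Cond. C.3 p. 18] -/
theorem datumValue_le_joint_datum_privacy_bound (h : S.Admissible) (U : Finset (Fin (S.n + 1)))
    (hU : (0 : Fin (S.n + 1)) ∉ U) (bk : Fin (S.n + 1) → ℤ)
    (hbkU : ∀ i ∈ U, ((S.p₁ : ℕ) : ℤ) ∣ bk i) (hbk : ∀ i, i ∉ U → bk i = S.b i)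
    (v' : Fin (S.n + 1) → ℤ) :
    datumValue S.Q U
      ≤ 1 / (S.Q : ℕ)
        + (1 - 1 / (S.Q : ℕ))
          * ((Nat.card {u : Fin (S.n + 1) → ZN S.D S.p₁ S.Q // ¬ IsGeneric S.n S.D S.p₁ S.Q U u} : ℝ)
              / ((S.N : ℕ) : ℝ) ^ (S.n + 1)) :=
  datumValue_le_coarse S.n S.D S.p₁ S.Q h.odd_P U bk S.b v' (h.p₁_dvd_of_mem hU) hbkU hbk
    (h.exists_unit_coord hU hbk)

end Literature.Computability.Cryptography.Chen2024.Shape
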